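import Summits.PneNP.PneNP.Theorems.ChebyshevTracialDesignClosedPairCount
import HarnessLib

/-!
# Cell pnp-psdrank, route `ChebyshevTracialDesign`: the rising-factorial Vandermonde identity and the perfect-matching
# counts as rising factorials — the two inputs of the closed form (S) for the even tight eigenvalues

Harmonic backbone, brick 5h (first half of (R3)'s remaining identity, MEMO-7 §E). The tail bound for the σ₂ brick needs the
closed form (S) `Σ_{d even} C(2κ,d)·pm(2κ−d)·pm(d)²·pm(n−2κ−d) = (2κ−1)!!·(n−4κ−1)!!·Π_{i<κ}(n−2κ−2i)` of eng's matching-side norm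
`ρ_κ` (p444030); MEMO-7 §E reduces it to the CHU–VANDERMONDE identity for rising factorials at `x = 1/2`. This file proves the two
generic inputs, with rising factorials written as explicit products (no new definitions):
* `rising_vandermonde` : `Σ_{j ≤ k} C(k,j) · Π_{i<j}(x+i) · Π_{i<k−j}(y+i) = Π_{i<k}(x+y+i)` for real `x, y` (induction on `k`, Pascal);
* `rising_split` : `Π_{i<a+b}(x+i) = Π_{i<a}(x+i) · Π_{i<b}(x+a+i)`;
* `pmCount_two_mul_eq_rising` : `pm(2m) = 2^m · Π_{i<m}(1/2 + i)` (from eng's `succ_mul_pmCount`, p442980) — the perfect-matching count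
  `(2m−1)!!` as a rising factorial [cite: Rothvoss2017, §2 (PDF p. 6): the level classes of the matching slack matrix are counted by
  such double factorials]; and `choose_two_mul_rising` : `C(2κ,2j)·Π_{i<κ−j}(1/2+i)·Π_{i<j}(1/2+i) = C(κ,j)·Π_{i<κ}(1/2+i)`.
[cite: GodsilMeagher2015, §15.2 (perfect matching scheme)] WHAT THIS IS NOT: (S) itself and the tail bound are the next file;
nothing on psd rank. Supports crux stmt-PneNP-19878.
-/

set_option linter.dupNamespace false -- `Summit.PneNP.PneNP.…`: summit = sub-problem (D-0017)

noncomputable section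

namespace Summit.PneNP.PneNP.Theorems.ChebyshevTracialDesignRisingVandermonde

open Finset Literature.Barriers.PneNP
open Summit.PneNP.PneNP.Theorems.ChebyshevTracialDesignClosedPairCount

/-! ### §1 Rising factorials as explicit products -/

/-- One more factor: `Π_{i<k+1}(x+i) = Π_{i<k}(x+i) · (x+k)`. -/
theorem rising_succ (x : ℝ) (k : ℕ) :
    ∏ i ∈ range (k + 1), (x + i) = (∏ i ∈ range k, (x + i)) * (x + k) := by
  rw [prod_range_succ]

/-- Splitting a rising factorial: `Π_{i<a+b}(x+i) = Π_{i<a}(x+i) · Π_{i<b}(x+a+i)`. -/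
theorem rising_split (x : ℝ) (a b : ℕ) :
    ∏ i ∈ range (a + b), (x + i) = (∏ i ∈ range a, (x + i)) * ∏ i ∈ range b, (x + a + i) := by
  rw [prod_range_add]
  congr 1
  refine prod_congr rfl fun i _ => ?_
  push_cast; ring

/-- **Chu–Vandermonde for rising factorials**:
`Σ_{j ≤ k} C(k,j) · Π_{i<j}(x+i) · Π_{i<k−j}(y+i) = Π_{i<k}(x+y+i)`. -/
theorem rising_vandermonde (x y : ℝ) : ∀ k : ℕ,
    ∑ j ∈ range (k + 1), (k.choose j : ℝ) * (∏ i ∈ range j, (x + i)) * (∏ i ∈ range (k - j), (y + i)) =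
      ∏ i ∈ range k, (x + y + i)
  | 0 => by simp
  | k + 1 => by
    rw [rising_succ, ← rising_vandermonde x y k, sum_mul]
    -- expand `(x+y+k) = (x+j) + (y+(k-j))` in the `j`-th term and regroup with Pascal's rule
    have hsplit : ∀ j ∈ range (k + 1),
        (k.choose j : ℝ) * (∏ i ∈ range j, (x + i)) * (∏ i ∈ range (k - j), (y + i)) * (x + y + k) =
        (k.choose j : ℝ) * (∏ i ∈ range (j + 1), (x + i)) * (∏ i ∈ range (k - j), (y + i)) +
        (k.choose j : ℝ) * (∏ i ∈ range j, (x + i)) * (∏ i ∈ range (k - j + 1), (y + i)) := by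
      intro j hj
      have hjk : j ≤ k := by have := mem_range.1 hj; omega
      rw [rising_succ x j, rising_succ y (k - j)]
      have : ((k - j : ℕ) : ℝ) = (k : ℝ) - j := by push_cast [hjk]; ring
      rw [this]; ring
    rw [sum_congr rfl hsplit, sum_add_distrib]
    -- abbreviations for the three sums involved
    -- T = f₀ + S1 + S3 (Pascal on the shifted target), S2 = f₀ + S3 (shift), hence S1 + S2 = T
    have hT : ∑ j ∈ range (k + 1 + 1), ((k + 1).choose j : ℝ) * (∏ i ∈ range j, (x + i)) *
        (∏ i ∈ range (k + 1 - j), (y + i)) =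
        (∏ i ∈ range (k + 1), (y + i)) +
        (∑ j ∈ range (k + 1), (k.choose j : ℝ) * (∏ i ∈ range (j + 1), (x + i)) * (∏ i ∈ range (k - j), (y + i)) +
         ∑ j ∈ range (k + 1), (k.choose (j + 1) : ℝ) * (∏ i ∈ range (j + 1), (x + i)) *
          (∏ i ∈ range (k - j), (y + i))) := by
      rw [sum_range_succ', Nat.choose_zero_right, ← sum_add_distrib]
      have htop : ∀ j ∈ range (k + 1), ((k + 1).choose (j + 1) : ℝ) * (∏ i ∈ range (j + 1), (x + i)) *
          (∏ i ∈ range (k + 1 - (j + 1)), (y + i)) =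
          (k.choose j : ℝ) * (∏ i ∈ range (j + 1), (x + i)) * (∏ i ∈ range (k - j), (y + i)) +
          (k.choose (j + 1) : ℝ) * (∏ i ∈ range (j + 1), (x + i)) * (∏ i ∈ range (k - j), (y + i)) := by
        intro j _
        rw [Nat.choose_succ_succ', Nat.cast_add, show k + 1 - (j + 1) = k - j by omega]; ring
      rw [sum_congr rfl htop]
      simp only [range_zero, prod_empty, Nat.sub_zero, Nat.cast_one, mul_one, one_mul]
      ring
    have hS2 : ∑ j ∈ range (k + 1), (k.choose j : ℝ) * (∏ i ∈ range j, (x + i)) *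
        (∏ i ∈ range (k - j + 1), (y + i)) =
        (∏ i ∈ range (k + 1), (y + i)) +
        ∑ j ∈ range (k + 1), (k.choose (j + 1) : ℝ) * (∏ i ∈ range (j + 1), (x + i)) *
          (∏ i ∈ range (k - j), (y + i)) := by
      rw [sum_range_succ' (fun j => (k.choose j : ℝ) * (∏ i ∈ range j, (x + i)) *
        (∏ i ∈ range (k - j + 1), (y + i))), sum_range_succ _ k, Nat.choose_succ_self, Nat.cast_zero, zero_mul,
        zero_mul, add_zero]
      simp only [range_zero, prod_empty, Nat.sub_zero, Nat.choose_zero_right, Nat.cast_one, mul_one, one_mul]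
      rw [add_comm]
      congr 1
      refine sum_congr rfl fun j hj => ?_
      rw [show k - (j + 1) + 1 = k - j by have := mem_range.1 hj; omega]
    rw [hT, hS2]
    ring

/-! ### §2 Perfect-matching counts as rising factorials at `1/2` -/

/-- **`pm(2m) = 2^m · Π_{i<m}(1/2 + i)`** (`= (2m−1)!!`). -/
theorem pmCount_two_mul_eq_rising (m : ℕ) :
    (pmCount (2 * m) : ℝ) = (2 : ℝ) ^ m * ∏ i ∈ range m, ((1 : ℝ) / 2 + i) := by
  induction m with
  | zero => simp [pmCount_zero]
  | succ m ih =>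
    have h := succ_mul_pmCount (2 * m)
    rw [show 2 * m + 2 = 2 * (m + 1) by ring] at h
    have h' : (((2 * m + 1 : ℕ) : ℝ)) * (pmCount (2 * m) : ℝ) = pmCount (2 * (m + 1)) := by exact_mod_cast h
    rw [← h', ih, rising_succ, pow_succ]
    push_cast; ring

/-- **The binomial-rising identity behind (S)**: `C(2κ,2j)·Π_{i<κ−j}(1/2+i)·Π_{i<j}(1/2+i) = C(κ,j)·Π_{i<κ}(1/2+i)` for `j ≤ κ`
(both sides are `(2κ)!/(4^κ j!(κ−j)!)`). -/
theorem choose_two_mul_rising {κ j : ℕ} (hj : j ≤ κ) :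
    ((2 * κ).choose (2 * j) : ℝ) * (∏ i ∈ range (κ - j), ((1 : ℝ) / 2 + i)) * (∏ i ∈ range j, ((1 : ℝ) / 2 + i)) =
      (κ.choose j : ℝ) * ∏ i ∈ range κ, ((1 : ℝ) / 2 + i) := by
  -- `2^m m! Π_{i<m}(1/2+i) = (2m)!` for every `m`
  have key : ∀ m : ℕ, (4 : ℝ) ^ m * (m.factorial : ℝ) * ∏ i ∈ range m, ((1 : ℝ) / 2 + i) = ((2 * m).factorial : ℝ) := by
    intro m
    induction m with
    | zero => simp
    | succ m ih =>
      rw [rising_succ, Nat.factorial_succ, show 2 * (m + 1) = 2 * m + 1 + 1 by ring, Nat.factorial_succ,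
        Nat.factorial_succ (2 * m)]
      push_cast
      linear_combination ((2 : ℝ) * ((m : ℝ) + 1) * (2 * (m : ℝ) + 1)) * ih
  have hk := key κ
  have hj' := key j
  have hkj := key (κ - j)
  -- binomial coefficients as factorial quotients
  have hc1 : ((2 * κ).choose (2 * j) : ℝ) * ((2 * j).factorial : ℝ) * ((2 * (κ - j)).factorial : ℝ) = ((2 * κ).factorial : ℝ) := by
    have h := Nat.choose_mul_factorial_mul_factorial (show 2 * j ≤ 2 * κ by omega)
    rw [show 2 * κ - 2 * j = 2 * (κ - j) by omega] at h
    exact_mod_cast h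
  have hc2 : (κ.choose j : ℝ) * (j.factorial : ℝ) * ((κ - j).factorial : ℝ) = (κ.factorial : ℝ) := by
    exact_mod_cast Nat.choose_mul_factorial_mul_factorial hj
  -- all factorials are nonzero: solve for the products
  have f1 : ((2 * j).factorial : ℝ) ≠ 0 := by positivity
  have f2 : ((2 * (κ - j)).factorial : ℝ) ≠ 0 := by positivity
  have f3 : (j.factorial : ℝ) ≠ 0 := by positivity
  have f4 : ((κ - j).factorial : ℝ) ≠ 0 := by positivity
  have f5 : (κ.factorial : ℝ) ≠ 0 := by positivity
  have epow : (4 : ℝ) ^ κ = (4 : ℝ) ^ j * (4 : ℝ) ^ (κ - j) := by rw [← pow_add, Nat.add_sub_cancel' hj]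
  -- express the three products
  have ek : ∏ i ∈ range κ, ((1 : ℝ) / 2 + i) = ((2 * κ).factorial : ℝ) / ((4 : ℝ) ^ κ * κ.factorial) := by
    rw [eq_div_iff (by positivity), ← hk]; ring
  have ej : ∏ i ∈ range j, ((1 : ℝ) / 2 + i) = ((2 * j).factorial : ℝ) / ((4 : ℝ) ^ j * j.factorial) := by
    rw [eq_div_iff (by positivity), ← hj']; ring
  have ekj : ∏ i ∈ range (κ - j), ((1 : ℝ) / 2 + i) = ((2 * (κ - j)).factorial : ℝ) / ((4 : ℝ) ^ (κ - j) * (κ - j).factorial) := by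
    rw [eq_div_iff (by positivity), ← hkj]; ring
  rw [ek, ej, ekj, epow]
  have hc1' : ((2 * κ).choose (2 * j) : ℝ) = ((2 * κ).factorial : ℝ) / (((2 * j).factorial : ℝ) * ((2 * (κ - j)).factorial : ℝ)) := by
    rw [eq_div_iff (by positivity), ← hc1]; ring
  have hc2' : (κ.choose j : ℝ) = (κ.factorial : ℝ) / ((j.factorial : ℝ) * ((κ - j).factorial : ℝ)) := by
    rw [eq_div_iff (by positivity), ← hc2]; ring
  rw [hc1', hc2']
  field_simp

end Summit.PneNP.PneNP.Theorems.ChebyshevTracialDesignRisingVandermonde
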